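import Summits.CriticalPhenomena.PercolationContinuityZ3.Theorems.Transplant.SkelPhiWinChainFactsF
import Summits.CriticalPhenomena.PercolationContinuityZ3.Theorems.Transplant.KNParaChainSchedNP
import HarnessLib

/-!
# N2 (frames-only node `SamePDropOfSkeletonFrm₁`, OPEN), (C)/(R) junction ((R-26)(ii)): **THE (S0) CHAIN OF ONE SCHEDULE-FRAME SEGMENT WITH A
# GENERIC SOURCE BOX AND A GENERIC LAW, IN THE SHAPE THE RESIDUES CONSUME** — `Skelφ.WinChainData.chainF_of_seg`: hp-8 g39's
# `chainFactsF_seg` (SkelPhiWinChainFactsF p340046) repackaged as the `Fin (N+1)`-indexed 7-tuple of `Skel.ReachOblAtHNF` (p3-g15's SkelKitResiduesOF)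
# / `Skel.RootOblTWF` (p340132): constant source, links, true ⊆ enlarged targets, `KitsAtF W'`, rim excess `≤ η`, **`B₀ ⊆ X^{(0)}_0`** for ANY
# `B₀ ⊆ 𝒲.W (S.core 0)`, last true target `= 𝒲.W (S.core (N+1))`; and `ChainPlanar.ScheduleNP.toFrame` (forget the route dichotomy), so that the
# K-G corridor `kgCorrSched` (SkelPhiParaCorridorKG p341223) — ONE schedule, ONE window — is read by this ONE lemma: (C) takes
# `B₀ := Γ.M (aOf₁O h e) (tgt e)`, `W' := Wcor`; the root legs of (R-26) take `B₀ :=` the seed window, `W' := W0pin`.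

builds on p205010 (kernel theorem, internal audit signed; external expert review pending) — nothing in this file uses p205010; nothing here is a
claim about the open node `SamePDropOfSkeletonFrm₁`.
Lane `prim-bschramm`, seat `prim-bschramm-p5` (gen 15; (C) lineage; p3-g15 (R-26)(ii) 2026-08-22T20:36:55Z); helper file (`--supports stmt-CriticalPhenomena-4575 --as helper`).
* §1 `ChainPlanar.ScheduleNP.toFrame`, `toFrame_spec`, `toFrame_core`, `toFrame_level`;
* §2 **`Skelφ.WinChainData.chainF_of_seg`**.
[cite: KozmaNitzan2024, §4 Lemma 11 (pp. 22–23), Lemma 12 (pp. 23–25), p. 30 (Step IV)]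
-/

noncomputable section

open MeasureTheory ProbabilityTheory
open scoped ENNReal

namespace Summit.CriticalPhenomena.PercolationContinuityZ3.Theorems.Transplant

/-! ## §1 A schedule with parking as a schedule frame -/

namespace ChainPlanar

/-- **The frame of a schedule with parking** (forget the stride data and the route dichotomy). [folklore] -/
def ScheduleNP.toFrame (S : ScheduleNP) : SchedFrame :=
  ⟨S.ax, S.lo, S.hi, S.region, S.prism, S.N, S.R', S.encl, S.succ, S.sub_prism, S.nonempty⟩

/-- The frame of a schedule with parking, field by field. [folklore] -/
theorem ScheduleNP.toFrame_spec (S : ScheduleNP) : S.toFrame.ax = S.ax ∧ S.toFrame.lo = S.lo ∧ S.toFrame.hi = S.hi ∧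
    S.toFrame.region = S.region ∧ S.toFrame.prism = S.prism ∧ S.toFrame.N = S.N ∧ S.toFrame.R' = S.R' := ⟨rfl, rfl, rfl, rfl, rfl, rfl, rfl⟩

/-- The cores of the frame are the cores of the schedule. [folklore] -/
theorem ScheduleNP.toFrame_core (S : ScheduleNP) (k : ℕ) : S.toFrame.core k = ScheduleNP.core S k := rfl

/-- The levels of the frame are the levels of the schedule. [folklore] -/
theorem ScheduleNP.toFrame_level (S : ScheduleNP) (k j : ℕ) : S.toFrame.level k j = ScheduleNP.level S k j := rfl

end ChainPlanar

/-! ## §2 The (S0) chain of one segment, residue shape, generic source and law -/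

namespace Skelφ

open Literature.Probability.Percolation Literature.Probability.LatticeModels SimpleGraph
open Literature.Probability.Percolation.KozmaNitzan
open KNLevels ChainPlanar

variable {V : Type} [DecidableEq V] {G' : SimpleGraph V} [G'.LocallyFinite]

namespace WinChainData

variable (P : WinChainData V) (𝒲 : PlanarWindow G') (S : SchedFrame)

/-- **THE (S0) CHAIN OF ONE SEGMENT, IN RESIDUE SHAPE, WITH A GENERIC SOURCE BOX AND LAW**: under the hypotheses of `chainFactsF_seg` (per-step forced-kit
clauses `hkits`, rim excess, counts, the law `W'` a sub-box law on every region) and `B₀ ⊆ 𝒲.W (S.core 0)`, the steps `stepAF` and true targets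
`coreTF` indexed by `Fin (S.N + 1)` satisfy: constant source `P.o`, links, true ⊆ enlarged targets, `KitsAtF W'` everywhere, rim excess `≤ η`,
`B₀ ⊆ X^{(0)}_0`, last true target `= 𝒲.W (S.core (S.N + 1))`. [cite: KozmaNitzan2024, §4 Lemma 12 (pp. 23–25), p. 30 (Step IV)] -/
theorem chainF_of_seg (hRl : P.Rlev + 1 ≤ S.R') (hRim : ∀ k, P.Rim k ⊆ 𝒲.stepDF S k) (hTne : ∀ k ≤ S.N, (𝒲.coreTF S k).Nonempty)
    {p : unitInterval} {W' : Sym2 V → unitInterval} {Δ' : ℕ} {δ η : ℝ}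
    (hsub : ∀ k ≤ S.N, IsSubbox G' W' p (𝒲.stepDF S k)) (hfin : FinSupp W' P.Sfin) (hDS : ∀ k ≤ S.N, 𝒲.stepDF S k ⊆ P.Sfin)
    (ho : ∀ k ≤ S.N, P.o ∉ 𝒲.stepDF S k) (hoS : P.o ∈ P.Sfin) (hj : P.j₁ ≤ P.Rlev)
    (hcount : 1 / (1 - (p : ℝ)) ^ (Δ' * P.N) ≤ δ * ((Finset.Icc P.j₀ P.j₁).card : ℝ))
    (hkits : ∀ k ≤ S.N, ∀ j ∈ Finset.Icc P.j₀ P.j₁, ∃ (σ : SData V) (Sz : Finset V),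
      SHyp (P.stepLF 𝒲 S k) j σ ∧ σ.N ≤ P.N ∧ (1 - (p : ℝ) ^ σ.sB) ^ σ.k ≤ δ ∧ Sz ⊆ 𝒲.stepDF S k ∧ (∀ x ∈ σ.K, σ.face x ⊆ Sz) ∧
      RelayClause (P.stepLF 𝒲 S k) W' j σ Sz (P.coreEF 𝒲 S k) (𝒲.stepDF S k) δ)
    (hexc : ∀ k ≤ S.N, (prodBernoulli W').real (⋃ t ∈ P.Rim k, openConn P.o t) ≤ η)
    {B₀ : Finset V} (hB₀ : B₀ ⊆ 𝒲.W (S.core 0)) :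
    ∃ (s : Fin (S.N + 1) → TStep G') (T' : Fin (S.N + 1) → Finset V),
      (∀ i, (s i).L.o = P.o) ∧ (∀ i : Fin S.N, T' (Fin.castSucc i) ⊆ (s i.succ).L.X 0) ∧ (∀ i, T' i ⊆ (s i).T) ∧
      (∀ i, (s i).KitsAtF W' p Δ' δ) ∧ (∀ i, (prodBernoulli W').real (⋃ t ∈ (s i).T \ T' i, openConn P.o t) ≤ η) ∧
      B₀ ⊆ (s 0).L.X 0 ∧ T' (Fin.last S.N) = 𝒲.W (S.core (S.N + 1)) := by
  have hF := P.chainFactsF_seg 𝒲 S hRl hRim hTne hsub hfin hDS ho hoS hj hcount hkits hexc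
  refine ⟨fun i => P.stepAF 𝒲 S i, fun i => 𝒲.coreTF S i, fun i => hF.src i (Nat.lt_succ_iff.1 i.isLt), fun i => ?_,
    fun i => hF.sub i (Nat.lt_succ_iff.1 i.isLt), fun i => hF.kits i (Nat.lt_succ_iff.1 i.isLt), fun i => hF.exc i (Nat.lt_succ_iff.1 i.isLt),
    ?_, rfl⟩
  · have h := hF.link i.val (by have := i.isLt; omega)
    simpa using h
  · show B₀ ⊆ (P.stepLF 𝒲 S 0).X 0
    rw [P.stepLF_X_zero 𝒲 S]; exact hB₀

end WinChainData

end Skelφ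

end Summit.CriticalPhenomena.PercolationContinuityZ3.Theorems.Transplant

end
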